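import Summits.CriticalPhenomena.PercolationContinuityZ3.Theses.PercOpenSupercrit
import Summits.CriticalPhenomena.PercolationContinuityZ3.Theorems.PercNearOneGluingNoHeavyLowerTailCSHTheoremOne
import Literature.Probability.Percolation.ContinuityCriterion
import HarnessLib

/-!
# `PercOpenSupercrit.PercOpenSupercritR5TwoPointDecay` (stmt-CriticalPhenomena-0685) — SETTLED after continuity

Item `stmt-CriticalPhenomena-0685` of route `CriticalPhenomena/PercOpenSupercrit` (support): `τ_{p_c}(0, x) → 0` as `x → ∞`.

`PercolationContinuity d ↔ (τ_{p_c}(0,·) → 0 along the cofinite filter)` (`percolationContinuity_iff_tendsto_tau`, Harris–FKG + uniqueness one way, `τ ≤` one-arm the other) applied to p205010.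

builds on p205010 (kernel theorem, internal audit signed; external expert review pending) — USED (`CSH.percolationContinuityZ3_holds`).  RSW3 lane, lead gen 28 (prover-prim-rsw3-lead-g28-0):
'after continuity — the ledger harvest'.
References: G. Kozma, N. Nitzan (2024), Thm. 6 / Conj. 3 [KozmaNitzan2024]; G. Grimmett, *Percolation* (1999), §8 [GrimmettPercolation1999].
-/

noncomputable section

namespace Summit.CriticalPhenomena.PercolationContinuityZ3.Theorems

namespace PercOpenSupercritPercOpenSupercritR5TwoPointDecay

open MeasureTheory Literature.Probability.Percolation Literature.Probability.LatticeModels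

/-- **`PercOpenSupercrit.PercOpenSupercritR5TwoPointDecay` (stmt-CriticalPhenomena-0685), settled.**  `percolationContinuity_iff_tendsto_tau (d := 3)` forward at p205010.
[cite: KozmaNitzan2024, Thm. 6 with Conj. 3 (p. 15)] -/
theorem percOpenSupercritR5TwoPointDecay_proof : Summit.CriticalPhenomena.PercolationContinuityZ3.Theses.PercOpenSupercrit.PercOpenSupercritR5TwoPointDecay := by
  unfold Summit.CriticalPhenomena.PercolationContinuityZ3.Theses.PercOpenSupercrit.PercOpenSupercritR5TwoPointDecay
  have h := (percolationContinuity_iff_tendsto_tau (d := 3)).1 CSH.percolationContinuityZ3_holds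
  exact h

end PercOpenSupercritPercOpenSupercritR5TwoPointDecay

end Summit.CriticalPhenomena.PercolationContinuityZ3.Theorems

end
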